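import Mathlib
import Literature.Computability.AlgebraicComplexity.MatrixMultiplicationExponent
import Summits.MatrixMultiplication.MatrixMultiplication.Theorems.FidelityWitnessesFidelityThesisSepMajorantSingleProduct

/-!
# `⟨n,n,n⟩` is spectrally flat (stub `stub_matMul_isFlat`)

Line `unit-tensor-orbit-nuclear-ratio` for the crux `FidelityWitnesses.DiagonalPowerDecay`
(`stmt-MatrixMultiplication-14053`).

Derksen's flatness `‖⟨n,n,n⟩‖_σ ≤ 1` of the matrix multiplication tensor (Derksen 2016, Thm. 1.9 /
Cor. 1.10, `‖⟨p,q,r⟩‖_σ = 1`): for all `w u v : Fin n × Fin n → ℂ`,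

  `|Σ_{a,b,c} w_a u_b v_c ⟨n,n,n⟩_{abc}| ≤ ‖w‖ ‖u‖ ‖v‖`.

Proof.  With the tree's convention `⟨n,n,n⟩(a,b,c) = [a.1 = b.1 ∧ b.2 = c.1 ∧ a.2 = c.2]`, read
`w, u, v` as `n × n` matrices `W_{κν} = w (κ,ν)`, `U_{κμ} = u (κ,μ)`, `V_{μν} = v (μ,ν)`; pairing the
product `u ⊗ v` against the output slice `⟨n,n,n⟩(a,·,·)` reads off `(UV)_a = Σ_m u (a.1,m) v (m,a.2)`,
so the sum is `Σ_a W_a (UV)_a`.  Cauchy–Schwarz in `a` (`sepMajorant_cauchySchwarz`) gives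
`|…|² ≤ ‖W‖_F² ‖UV‖_F²`, and the single-product law `‖UV‖_F² ≤ ‖U‖_F² ‖V‖_F²`
(`sepMajorant_singleProductLaw`, Cauchy–Schwarz in `m` entrywise, summed over `a = (κ,ν)`) finishes;
take square roots (`Real.sqrt_mul`, `Real.le_sqrt_of_sq_le`).  Uses the landed toolkit
`FidelityWitnessesFidelityThesisSepMajorantSingleProduct` and Mathlib; supports item
`stmt-MatrixMultiplication-14053`; no definitions.
-/

-- the tree's namespace `Summit.MatrixMultiplication.MatrixMultiplication.…` repeats a component by design
set_option linter.dupNamespace false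

namespace Summit.MatrixMultiplication.MatrixMultiplication.Theorems.DiagonalPowerDecay

open scoped BigOperators
open Literature.Computability.AlgebraicComplexity

/-- **Stub `stub_matMul_isFlat` — the lever: `⟨n,n,n⟩` is spectrally flat (`‖⟨n,n,n⟩‖_σ ≤ 1`).**
For all `w u v : Fin n × Fin n → ℂ`,
`|Σ_{a,b,c} w_a u_b v_c ⟨n,n,n⟩_{abc}| ≤ √(Σ|w|²) · √(Σ|u|²) · √(Σ|v|²)`: every triad overlap of the
matrix multiplication tensor is at most the product of the factor norms (Derksen 2016, Cor. 1.10: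
`‖⟨p,q,r⟩‖_σ = 1`).  Proof: `Σ = Σ_a w_a (UV)_a`, Cauchy–Schwarz in `a`, then the single-product law
`‖UV‖_F ≤ ‖U‖_F ‖V‖_F`. -/
theorem stub_matMul_isFlat :
    ∀ (n : ℕ) (w u v : Fin n × Fin n → ℂ),
      ‖∑ a, ∑ b, ∑ c, w a * u b * v c * matMulTensor ℂ n n n a b c‖ ≤
        Real.sqrt (∑ a, ‖w a‖ ^ 2) * Real.sqrt (∑ b, ‖u b‖ ^ 2) * Real.sqrt (∑ c, ‖v c‖ ^ 2) := by
  intro n w u v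
  -- pull `w a` out of the inner sums: `Σ_{abc} w_a u_b v_c T_{abc} = Σ_a w_a · Σ_{bc} u_b v_c T_{abc}`
  have hre : (∑ a, ∑ b, ∑ c, w a * u b * v c * matMulTensor ℂ n n n a b c) =
      ∑ a, w a * ∑ b, ∑ c, u b * v c * matMulTensor ℂ n n n a b c := by
    refine Finset.sum_congr rfl fun a _ => ?_
    rw [Finset.mul_sum]
    refine Finset.sum_congr rfl fun b _ => ?_
    rw [Finset.mul_sum]
    exact Finset.sum_congr rfl fun c _ => by ring
  -- the squared inequality: Cauchy–Schwarz in `a`, then the single-product law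
  have key : ‖∑ a, ∑ b, ∑ c, w a * u b * v c * matMulTensor ℂ n n n a b c‖ ^ 2 ≤
      (∑ a, ‖w a‖ ^ 2) * ((∑ b, ‖u b‖ ^ 2) * ∑ c, ‖v c‖ ^ 2) := by
    rw [hre]
    exact (sepMajorant_cauchySchwarz _ _).trans
      (mul_le_mul_of_nonneg_left (sepMajorant_singleProductLaw u v)
        (Finset.sum_nonneg fun _ _ => by positivity))
  have hw : 0 ≤ ∑ a, ‖w a‖ ^ 2 := Finset.sum_nonneg fun _ _ => by positivity
  have hu : 0 ≤ ∑ b, ‖u b‖ ^ 2 := Finset.sum_nonneg fun _ _ => by positivity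
  rw [mul_assoc, ← Real.sqrt_mul hu, ← Real.sqrt_mul hw]
  exact Real.le_sqrt_of_sq_le key

end Summit.MatrixMultiplication.MatrixMultiplication.Theorems.DiagonalPowerDecay
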